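import Mathlib
import HarnessLib
import Summits.HubbardSuperconductivity.HubbardSuperconductivity.Theorems.KLProgrammeCooperChannelRiccatiFlow

/-!
# Route `KLProgramme` — DECOMP C2 «ChannelRiccati» in Lean, II: the cascade (Möbius) step `T ↦ T (1 + b T)⁻¹`
# and the tops of the forms

Cell gate-hubbard-kl, seat p3; continuation of `KLProgrammeCooperChannelRiccatiFlow.lean` (same namespace, same method).
DECOMP App. E, E2 (c1): the pure particle–particle cascades at one scale resum to the exact single-scale ladder
`V (1 + P V)⁻¹`, so the one-step comparison of C2 must also be available for the Möbius map `x ↦ x / (1 + b x)`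
(`cascadeStep`), not only for its quadratic truncation `x - b x²` (`riccatiStep`, file I).  Main results:

* `formInf_cascade` — for symmetric bounded `T`, `|b| ‖T‖ ≤ 1/4` and a two-sided inverse `R` of `1 + b T`:
  `formInf (T * R) = cascadeStep b (formInf T)`;
* `abs_formInf_cascade_add_sub_le`, `c2OneStep_cascade` — the shape `C2OneStepCascade E`: with any bounded remainder `P`,
  `|formInf (T * R + P) - cascadeStep b (formInf T)| ≤ ‖P‖`;
* `formSup_riccati`, `formSup_cascade` — the TOP of the form (`formSup T = - formInf (-T)`) follows the same scalar maps
  (read the bottom theorems for `-T`; used for the repulsive `A1g` block, DECOMP App. E, E.4).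

Method: every unit `v` is `(1 + bT) w` with `w = R v`, and `Re ⟪(1 + bT) w, T w⟫ (1 + b m) - m ‖(1 + bT) w‖² =
σ(w) (1 + b m) + b κ(w)` (`cascade_identity`) with `0 ≤ σ (1 + bm) + bκ ≤ 2σ` for `|b| ‖T‖ ≤ 1/4` (file I,
`cascade_core_nonneg/le`); dividing by `1 + b m > 0` gives the lower bound, and pushing an approximate minimiser `u` of
`T` through `1 + bT` gives the upper bound.

References: HOME/DECOMP.md v6 §2 C2, App. E (E2 (c1), E.4).
-/

noncomputable section

namespace Summit.HubbardSuperconductivity.HubbardSuperconductivity.Theorems.CooperChannelRiccatiFlow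

set_option linter.dupNamespace false -- summit = problem name (single-conjunct summit), D-0017

open scoped InnerProductSpace ComplexConjugate
open RCLike ContinuousLinearMap

variable {E : Type*} [NormedAddCommGroup E] [InnerProductSpace ℂ E]

/-! ## The cascade (Möbius) step `T ↦ T (1 + b T)⁻¹` -/

section Cascade

variable {T : E →L[ℂ] E}

/-- `(1 + b T) w = w + b T w`. -/
theorem one_add_smul_apply (b : ℝ) (T : E →L[ℂ] E) (w : E) : (1 + b • T) w = w + (b : ℂ) • T w := by
  show w + (b • T) w = _
  rw [real_smul_apply]

/-- `Re ⟪(1 + b T) w, T w⟫ = Re ⟪w, T w⟫ + b ‖T w‖²`. -/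
theorem re_inner_one_add_smul_apply (b : ℝ) (T : E →L[ℂ] E) (w : E) :
    re ⟪(1 + b • T) w, T w⟫_ℂ = re ⟪w, T w⟫_ℂ + b * ‖T w‖ ^ 2 := by
  rw [one_add_smul_apply, inner_add_left, map_add, re_inner_real_smul_left, inner_self_eq_norm_sq (𝕜 := ℂ)]

/-- `‖(1 + b T) w‖² = ‖w‖² + 2 b Re ⟪w, T w⟫ + b² ‖T w‖²`. -/
theorem norm_sq_one_add_smul_apply (b : ℝ) (T : E →L[ℂ] E) (w : E) :
    ‖(1 + b • T) w‖ ^ 2 = ‖w‖ ^ 2 + 2 * b * re ⟪w, T w⟫_ℂ + b ^ 2 * ‖T w‖ ^ 2 := by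
  rw [one_add_smul_apply, @norm_add_sq ℂ, inner_smul_right, norm_smul, Complex.norm_real, Real.norm_eq_abs,
    mul_pow, sq_abs]
  simp [RCLike.re_to_complex]
  ring

/-- `‖(1 + b T) w‖ ≥ (1 - |b| ‖T‖) ‖w‖`. -/
theorem norm_one_add_smul_apply_ge (b : ℝ) (T : E →L[ℂ] E) (w : E) :
    (1 - |b| * ‖T‖) * ‖w‖ ≤ ‖(1 + b • T) w‖ := by
  rw [one_add_smul_apply]
  have h1 : ‖w‖ ≤ ‖w + (b : ℂ) • T w‖ + ‖(b : ℂ) • T w‖ := by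
    simpa using norm_sub_le (w + (b : ℂ) • T w) ((b : ℂ) • T w)
  have h2 : ‖(b : ℂ) • T w‖ ≤ |b| * ‖T‖ * ‖w‖ := by
    rw [norm_smul, Complex.norm_real, Real.norm_eq_abs, mul_assoc]
    gcongr
    exact T.le_opNorm w
  nlinarith

/-- The algebraic identity behind the cascade comparison: with `A = Re ⟪w, T w⟫`, `ρ = ‖w‖²`, `τ = ‖T w‖²`,
`σ = A - m ρ`, `κ = ‖T w - m w‖²` one has `(A + b τ)(1 + b m) - m (ρ + 2 b A + b² τ) = σ (1 + b m) + b κ`. -/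
theorem cascade_identity (T : E →L[ℂ] E) (m b : ℝ) (w : E) :
    (re ⟪w, T w⟫_ℂ + b * ‖T w‖ ^ 2) * (1 + b * m) -
        m * (‖w‖ ^ 2 + 2 * b * re ⟪w, T w⟫_ℂ + b ^ 2 * ‖T w‖ ^ 2) =
      (re ⟪w, T w⟫_ℂ - m * ‖w‖ ^ 2) * (1 + b * m) + b * ‖T w - (m : ℂ) • w‖ ^ 2 := by
  rw [norm_sq_apply_eq T m w]
  ring

/-- **The bottom of the form of `T (1 + b T)⁻¹` is the Möbius image of the bottom of `T`.**  For a symmetric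
bounded `T` on a complex inner-product space, a real `b` with `|b| ‖T‖ ≤ 1/4` and a two-sided inverse `R` of
`1 + b T`: `formInf (T R) = cascadeStep b (formInf T) = formInf T / (1 + b · formInf T)`. -/
theorem formInf_cascade (hT : (T : E →ₗ[ℂ] E).IsSymmetric) {b : ℝ} (hb : |b| * ‖T‖ ≤ 1 / 4)
    {R : E →L[ℂ] E} (hR₁ : (1 + b • T) * R = 1) (hR₂ : R * (1 + b • T) = 1) :
    formInf (T * R) = cascadeStep b (formInf T) := by
  rcases subsingleton_or_nontrivial E with hE | hE
  · simp [formInf_of_subsingleton, cascadeStep]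
  set m := formInf T with hm_def
  have hmN : |m| ≤ ‖T‖ := abs_formInf_le_norm T
  have hbm := abs_le.mp (abs_mul_le_quarter hmN hb)
  have h1bm : 0 < 1 + b * m := by linarith [hbm.1]
  have hbT : |b| * ‖T‖ ≤ 1 / 4 := hb
  apply le_antisymm
  · -- upper bound: push an approximate minimiser `u` of `T` through `1 + b T`
    refine le_of_forall_pos_lt_add fun ε hε => ?_
    obtain ⟨u, hu, hlt⟩ := exists_re_inner_lt_of_formInf_lt T (show formInf T < m + ε / 8 by linarith)
    obtain ⟨hσ, hκ⟩ := shift_bounds_unit hT hu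
    rw [← hm_def] at hσ hκ
    have hcore := cascade_core_le hσ (sq_nonneg _) hκ hmN hb
    set y : E := (1 + b • T) u with hy_def
    have hRy : R y = u := by
      have := congrArg (fun S : E →L[ℂ] E => S u) hR₂
      exact this
    have hy0 : y ≠ 0 := by
      intro h
      have : u = 0 := by rw [← hRy, h, map_zero]
      rw [this, norm_zero] at hu
      exact zero_ne_one hu
    have hD : (9 : ℝ) / 16 ≤ ‖y‖ ^ 2 := by
      have h34 : 3 / 4 ≤ ‖y‖ := by
        have := norm_one_add_smul_apply_ge b T u
        rw [hu, mul_one] at this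
        linarith
      nlinarith
    have hDpos : 0 < ‖y‖ ^ 2 := by positivity
    set v : E := ((‖y‖ : ℂ)⁻¹) • y with hv_def
    have hv : ‖v‖ = 1 := norm_normalize hy0
    have hTRy : (T * R) y = T u := by
      show T (R y) = T u
      rw [hRy]
    have hvalv : re ⟪v, (T * R) v⟫_ℂ = ‖y‖⁻¹ ^ 2 * (re ⟪u, T u⟫_ℂ + b * ‖T u‖ ^ 2) := by
      rw [hv_def, re_inner_normalize (T * R) y, hTRy, hy_def, re_inner_one_add_smul_apply]
    have hnormy : ‖y‖ ^ 2 = ‖u‖ ^ 2 + 2 * b * re ⟪u, T u⟫_ℂ + b ^ 2 * ‖T u‖ ^ 2 := by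
      rw [hy_def, norm_sq_one_add_smul_apply]
    have hid := cascade_identity T m b u
    rw [← hnormy, hu, one_pow, mul_one] at hid
    -- `(A + bτ)(1 + bm) = m ‖y‖² + (σ(1+bm) + bκ) ≤ m ‖y‖² + 2σ < m ‖y‖² + ε/4 ≤ m ‖y‖² + ε ‖y‖² (1+bm)`
    have hprod : 27 / 64 ≤ ‖y‖ ^ 2 * (1 + b * m) := by nlinarith
    have h27 : ε * (27 / 64) ≤ ε * (‖y‖ ^ 2 * (1 + b * m)) := mul_le_mul_of_nonneg_left hprod hε.le
    have hcs : cascadeStep b m * (1 + b * m) = m := div_mul_cancel₀ m h1bm.ne'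
    have hc : (cascadeStep b m + ε) * ‖y‖ ^ 2 * (1 + b * m) =
        m * ‖y‖ ^ 2 + ε * (‖y‖ ^ 2 * (1 + b * m)) := by
      linear_combination (‖y‖ ^ 2) * hcs
    have key : (re ⟪u, T u⟫_ℂ + b * ‖T u‖ ^ 2) * (1 + b * m) <
        m * ‖y‖ ^ 2 + ε * (‖y‖ ^ 2 * (1 + b * m)) := by
      linarith
    have key2 : re ⟪u, T u⟫_ℂ + b * ‖T u‖ ^ 2 < (cascadeStep b m + ε) * ‖y‖ ^ 2 := by
      refine lt_of_mul_lt_mul_right ?_ h1bm.le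
      rw [hc]
      exact key
    calc formInf (T * R) ≤ re ⟪v, (T * R) v⟫_ℂ := formInf_le _ hv
      _ = ‖y‖⁻¹ ^ 2 * (re ⟪u, T u⟫_ℂ + b * ‖T u‖ ^ 2) := hvalv
      _ < cascadeStep b m + ε := by
          rw [inv_pow, inv_mul_lt_iff₀ hDpos]
          linarith [key2]
  · -- lower bound: every unit `v` is `(1 + bT) w` with `w = R v`
    refine le_formInf _ fun v hv => ?_
    set w : E := R v with hw_def
    have hvw : (1 + b • T) w = v := by
      have := congrArg (fun S : E →L[ℂ] E => S v) hR₁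
      exact this
    have hA : re ⟪v, (T * R) v⟫_ℂ = re ⟪w, T w⟫_ℂ + b * ‖T w‖ ^ 2 := by
      have h := re_inner_one_add_smul_apply b T w
      rw [hvw] at h
      exact h
    have hnorm : ‖w‖ ^ 2 + 2 * b * re ⟪w, T w⟫_ℂ + b ^ 2 * ‖T w‖ ^ 2 = 1 := by
      rw [← norm_sq_one_add_smul_apply, hvw, hv, one_pow]
    have hσ := shiftedForm_nonneg T w
    have hκ := norm_sq_shift_apply_le hT w
    rw [← hm_def] at hσ hκ
    have hcore := cascade_core_nonneg hσ (sq_nonneg _) hκ hmN hb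
    have hid := cascade_identity T m b w
    rw [hnorm, mul_one] at hid
    rw [hA, cascadeStep, div_le_iff₀ h1bm]
    linarith

/-- **C2-one-step, cascade form** (DECOMP App. E, E2 (c1)): for symmetric bounded `T`, `|b| ‖T‖ ≤ 1/4`, a two-sided
inverse `R` of `1 + b T` and any bounded `P`: `|formInf (T R + P) - cascadeStep b (formInf T)| ≤ ‖P‖`. -/
theorem abs_formInf_cascade_add_sub_le (hT : (T : E →ₗ[ℂ] E).IsSymmetric) {b : ℝ}
    (hb : |b| * ‖T‖ ≤ 1 / 4) {R : E →L[ℂ] E} (hR₁ : (1 + b • T) * R = 1) (hR₂ : R * (1 + b • T) = 1)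
    (P : E →L[ℂ] E) :
    |formInf (T * R + P) - cascadeStep b (formInf T)| ≤ ‖P‖ := by
  rw [← formInf_cascade hT hb hR₁ hR₂]
  exact abs_formInf_add_sub_le _ P

/-- **`C2OneStepCascade E`** (shape of record for the cascade map): for self-adjoint bounded `T` on a complex Hilbert
space, `0 ≤ b`, `b ‖T‖ ≤ 1/4`, a two-sided inverse `R` of `1 + b T` and any bounded `P`,
`|formInf (T * R + P) - cascadeStep b (formInf T)| ≤ ‖P‖`. -/
theorem c2OneStep_cascade [CompleteSpace E] :
    ∀ (T R P : E →L[ℂ] E) (b : ℝ), IsSelfAdjoint T → 0 ≤ b → b * ‖T‖ ≤ 1 / 4 →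
      (1 + b • T) * R = 1 → R * (1 + b • T) = 1 →
      |formInf (T * R + P) - cascadeStep b (formInf T)| ≤ ‖P‖ := by
  intro T R P b hT hb hbT hR₁ hR₂
  have hT' : (T : E →ₗ[ℂ] E).IsSymmetric := ContinuousLinearMap.isSelfAdjoint_iff_isSymmetric.mp hT
  exact abs_formInf_cascade_add_sub_le hT' (by rwa [abs_of_nonneg hb]) hR₁ hR₂ P

end Cascade

/-! ## The top of the form: `formSup T = - formInf (-T)` -/

section FormSup

variable {T : E →L[ℂ] E}

/-- `Re ⟪v, T v⟫ ≤ formSup T` for every unit vector `v`. -/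
theorem re_inner_le_formSup (T : E →L[ℂ] E) {v : E} (hv : ‖v‖ = 1) : re ⟪v, T v⟫_ℂ ≤ formSup T := by
  have h := formInf_le (-T) hv
  rw [show (-T) v = -(T v) from rfl, inner_neg_right, map_neg] at h
  rw [formSup]
  linarith

/-- A uniform upper bound of the form on the unit sphere bounds `formSup` (nontrivial space). -/
theorem formSup_le [Nontrivial E] (T : E →L[ℂ] E) {c : ℝ} (h : ∀ v : E, ‖v‖ = 1 → re ⟪v, T v⟫_ℂ ≤ c) :
    formSup T ≤ c := by
  have := le_formInf (-T) (c := -c) fun v hv => by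
    rw [show (-T) v = -(T v) from rfl, inner_neg_right, map_neg]
    linarith [h v hv]
  rw [formSup]
  linarith

/-- On a nontrivial space `formInf T ≤ formSup T`. -/
theorem formInf_le_formSup [Nontrivial E] (T : E →L[ℂ] E) : formInf T ≤ formSup T := by
  obtain ⟨v, hv⟩ := exists_norm_eq_one (E := E)
  exact (formInf_le T hv).trans (re_inner_le_formSup T hv)

/-- `|formSup T| ≤ ‖T‖`. -/
theorem abs_formSup_le_norm (T : E →L[ℂ] E) : |formSup T| ≤ ‖T‖ := by
  rw [formSup, abs_neg, ← norm_neg T]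
  exact abs_formInf_le_norm (-T)

/-- **Form perturbation for the top:** `|formSup (A + P) - formSup A| ≤ ‖P‖`. -/
theorem abs_formSup_add_sub_le (A P : E →L[ℂ] E) : |formSup (A + P) - formSup A| ≤ ‖P‖ := by
  have h := abs_formInf_add_sub_le (-A) (-P)
  rw [← neg_add, norm_neg] at h
  rw [formSup, formSup, show -formInf (-(A + P)) - -formInf (-A) = -(formInf (-(A + P)) - formInf (-A)) by ring,
    abs_neg]
  exact h

/-- The negative of a symmetric operator is symmetric. -/
theorem isSymmetric_neg (hT : (T : E →ₗ[ℂ] E).IsSymmetric) : ((-T : E →L[ℂ] E) : E →ₗ[ℂ] E).IsSymmetric := by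
  intro x y
  show ⟪(-T) x, y⟫_ℂ = ⟪x, (-T) y⟫_ℂ
  rw [show (-T) x = -(T x) from rfl, show (-T) y = -(T y) from rfl, inner_neg_left, inner_neg_right,
    hT.apply_clm x y]

/-- **The top of the form of `T - b T²` is the Riccati image of the top of `T`** (symmetric `T`, `|b| ‖T‖ ≤ 1/4):
`formSup (T - b • (T * T)) = riccatiStep b (formSup T)` — the repulsive-block reading of `formInf_riccati`. -/
theorem formSup_riccati (hT : (T : E →ₗ[ℂ] E).IsSymmetric) {b : ℝ} (hb : |b| * ‖T‖ ≤ 1 / 4) :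
    formSup (T - b • (T * T)) = riccatiStep b (formSup T) := by
  have hb' : |(-b)| * ‖-T‖ ≤ 1 / 4 := by rwa [abs_neg, norm_neg]
  have h := formInf_riccati (isSymmetric_neg hT) hb'
  have hop : (-T) - (-b) • ((-T) * (-T)) = -(T - b • (T * T)) := by
    rw [neg_mul_neg, neg_smul, sub_neg_eq_add, neg_sub]
    abel
  rw [hop] at h
  rw [formSup, formSup, h, riccatiStep, riccatiStep]
  ring

/-- **The top of the form of `T (1 + bT)⁻¹` is the Möbius image of the top of `T`** (symmetric `T`,
`|b| ‖T‖ ≤ 1/4`, `R` a two-sided inverse of `1 + b T`): `formSup (T * R) = cascadeStep b (formSup T)`. -/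
theorem formSup_cascade (hT : (T : E →ₗ[ℂ] E).IsSymmetric) {b : ℝ} (hb : |b| * ‖T‖ ≤ 1 / 4)
    {R : E →L[ℂ] E} (hR₁ : (1 + b • T) * R = 1) (hR₂ : R * (1 + b • T) = 1) :
    formSup (T * R) = cascadeStep b (formSup T) := by
  have hb' : |(-b)| * ‖-T‖ ≤ 1 / 4 := by rwa [abs_neg, norm_neg]
  have hR₁' : (1 + (-b) • (-T)) * R = 1 := by rwa [neg_smul_neg]
  have hR₂' : R * (1 + (-b) • (-T)) = 1 := by rwa [neg_smul_neg]
  have h := formInf_cascade (isSymmetric_neg hT) hb' hR₁' hR₂'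
  rw [neg_mul] at h
  rw [formSup, formSup, h, cascadeStep, cascadeStep]
  have : (1 + b * -formInf (-T)) = 1 + -b * formInf (-T) := by ring
  rw [this, neg_div]

end FormSup

end Summit.HubbardSuperconductivity.HubbardSuperconductivity.Theorems.CooperChannelRiccatiFlow

end
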